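import Summits.SmoothPoincare4.SmoothPoincare4.Theses.InformationMetricHadamard
import Literature.Geometry.GaugeTheory.AsdModuliSpace

/-!
# Route `InformationMetricHadamard`, crux `AhHadamardFilling` (stmt-SmoothPoincare4-6014):
# vocabulary of the line `fisher-sphere-gauss`

Route-posited objects (D-0016 `<Route>Defs` file) shared by the registered stubs of the checked skeleton
`Cruxes/AhHadamardFilling/Lines/fisher_sphere_gauss.lean` (stubs `stub_coreSaddleDominance`,
`stub_instantonCollarPackage`, `stub_fisherRaoMetric`, `stub_hellingerGaussEquation`,
`stub_collarEndHadamard`, registered on stmt-SmoothPoincare4-6014) and by the crux file that composes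
them. Everything here is a plain definition with explicit parameters over existing tree / Mathlib
declarations (`fderiv`, `extChartAt`, `MeasureTheory.integral`,
`Literature.Geometry.Lorentzian.riemannianMeasure`,
`Literature.Geometry.Lorentzian.PseudoRiemannianMetric.toContMDiffRiemannianMetric`,
`Literature.Geometry.GaugeTheory.AsdModuliSpace`, `.density`), a `Prop`-valued PREDICATE with
explicit parameters, or a PROVED lemma; nothing is asserted and no closed proposition is defined.

* `chartFamily θ w` / `D1 θ w X` / `D2 θ w X Y` — the chart representative at the base point `w` of a
  parametrised family of functions `θ : W → (N → ℝ)` on a 5-manifold `W`, and its first / second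
  parameter derivatives, pointwise in `x ∈ N` (`D1 θ w X x = mfderiv (θ · x) w X` read in the chart).
* `gIntegral gN hgN f = ∫_N f dvol_{gN}` — integral against the Riemannian measure of `gN`.
* `fisherForm gN hgN θ w X Y = ∫_N D1θ(X) · D1θ(Y) dvol` — the Fisher form of the family in Hellinger
  normalisation (for `θ = 2√ρ` it is the Fisher–Rao / information form `∫ δ_Xρ δ_Yρ / ρ` of the
  density family `ρ`; Amari–Nagaoka 2000 §2.2, Groisser–Murray 1997 §2 (metric1)).
* `IsNormalPart gN hgN θ w X Y h` — `h` is the normal part (second fundamental form in flat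
  `L²(N, dvol)`) of the chart Hessian of `θ` on `(X, Y)`; `saddleForm gN hgN hXX hXY hYY =
  ‖h_XY‖² − ⟨h_XX, h_YY⟩` — minus the Gauss term.
* `hellinger ι w x = 2 √ρ_{ι w}(x)` — the Hellinger (square-root) map of a model
  `ι : W → M₁(Σ, g) = AsdModuliSpace g Σ.orientation 1` through the tree's `density`;
  `IsModuliModel ι` — `ι` is an open topological embedding with closed range containing every
  sufficiently concentrated class, along which the universal density is jointly smooth.
* PROVED API (sanity / non-vacuity): `fisherForm_comm` (symmetry), `D1_zero`, `D2_zero`,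
  `isNormalPart_zero` (for the zero family the zero function is a normal part — the predicate is
  satisfiable), `saddleForm_zero`.

Authorship: the definitions are the planner's
(planner-cruxplan-stmt-SmoothPoincare4-6014-fisher-sphere-gauss-0, skeleton round 1), moved here
verbatim by the line lead (prover-line-stmt-SmoothPoincare4-6014-c3-0) so that landed stub files can
import them; the proved API is the lead's.

References: S. Amari, H. Nagaoka, *Methods of Information Geometry* (AMS 2000), §2.2 (Fisher metric);
D. Groisser, M. K. Murray, *Instantons and the information metric*, Ann. Global Anal. Geom. 15 (1997)
519–537 (dg-ga/9611008), §2; J. M. Lee, *Introduction to Riemannian Manifolds* (2nd ed. 2018), Ch. 8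
(second fundamental form, Gauss equation); D. Freed, K. Uhlenbeck, *Instantons and four-manifolds*
(1984), Ch. 3.
-/

noncomputable section

-- the prescribed namespace `Summit.<P>.<Sub>.…` duplicates `SmoothPoincare4` (P = Sub)
set_option linter.dupNamespace false

open scoped Manifold ContDiff Topology ENNReal NNReal
open Set Function MeasureTheory Topology

namespace Summit.SmoothPoincare4.SmoothPoincare4.Cruxes.AhHadamardFilling.FisherSphereGauss

open Literature.Topology.FourManifolds (HomotopySphere)
open Literature.Geometry.Lorentzian (PseudoRiemannianMetric riemannianMeasure)
open Literature.Geometry.GaugeTheory (AsdModuliSpace)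

/-! ## Families of functions parametrised by a 5-manifold -/

section Vocabulary

variable {N : Type*} [TopologicalSpace N] [ChartedSpace (EuclideanSpace ℝ (Fin 4)) N]
variable {W : Type*} [TopologicalSpace W] [ChartedSpace (EuclideanSpace ℝ (Fin 5)) W]

/-- The representative of a parametrised family of functions `θ : W → (N → ℝ)` in the preferred
extended chart of `W` at the base point `w`: `y ↦ θ (φ_w⁻¹ y)`. [folklore] -/
def chartFamily (θ : W → N → ℝ) (w : W) (y : EuclideanSpace ℝ (Fin 5)) (x : N) : ℝ :=
  θ ((extChartAt (𝓡 5) w).symm y) x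

/-- **First parameter derivative** of the family at `w` in the direction `X ∈ T_w W = ℝ⁵`, pointwise
in `x`: `D1 θ w X x = d(θ(·)(x))_w X` (this is `mfderiv (𝓡 5) 𝓘(ℝ,ℝ) (θ · x) w X`, written through the
chart at `w`; `range (𝓡 5) = univ`). For `θ = 2√ρ`: `D1 θ = δρ/√ρ`. [folklore] -/
def D1 (θ : W → N → ℝ) (w : W) (X : EuclideanSpace ℝ (Fin 5)) (x : N) : ℝ :=
  fderiv ℝ (fun y ↦ chartFamily θ w y x) (extChartAt (𝓡 5) w w) X

/-- **Second parameter derivative** (chart Hessian at the base point) of the family, pointwise in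
`x`: `D2 θ w X Y x = ∂_Y ∂_X (θ ∘ φ_w⁻¹)(·)(x)` at `φ_w w`. Chart-dependent only through a TANGENTIAL
term `D1 θ w (Γ(X,Y))`, which `IsNormalPart` quotients out. [folklore] -/
def D2 (θ : W → N → ℝ) (w : W) (X Y : EuclideanSpace ℝ (Fin 5)) (x : N) : ℝ :=
  fderiv ℝ (fun y ↦ fderiv ℝ (fun y' ↦ chartFamily θ w y' x) y X) (extChartAt (𝓡 5) w w) Y

omit [TopologicalSpace N] [ChartedSpace (EuclideanSpace ℝ (Fin 4)) N] in
/-- The first parameter derivative of the zero family vanishes. [folklore] -/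
@[simp] theorem D1_zero (w : W) (X : EuclideanSpace ℝ (Fin 5)) (x : N) :
    D1 (fun (_ : W) (_ : N) ↦ (0 : ℝ)) w X x = 0 := by
  simp [D1, chartFamily]

omit [TopologicalSpace N] [ChartedSpace (EuclideanSpace ℝ (Fin 4)) N] in
/-- The second parameter derivative of the zero family vanishes. [folklore] -/
@[simp] theorem D2_zero (w : W) (X Y : EuclideanSpace ℝ (Fin 5)) (x : N) :
    D2 (fun (_ : W) (_ : N) ↦ (0 : ℝ)) w X Y x = 0 := by
  simp [D2, chartFamily]

variable [T3Space N] [IsManifold (𝓡 4) ∞ N]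

/-- `∫_N f dvol_{gN}` — the integral against the Riemannian measure of the Riemannian metric `gN`
(Borel σ-algebra), as in `Literature.Geometry.GaugeTheory.SpOneConnection.ymAction`. [folklore] -/
def gIntegral (gN : PseudoRiemannianMetric (𝓡 4) ∞ (EuclideanSpace ℝ (Fin 4)) (TangentSpace (𝓡 4) : N → Type _))
    (hgN : gN.IsRiemannian) (f : N → ℝ) : ℝ :=
  letI : MeasurableSpace N := borel N
  haveI : BorelSpace N := ⟨rfl⟩
  ∫ x, f x ∂(riemannianMeasure (gN.toContMDiffRiemannianMetric hgN))

/-- The integral of the zero function vanishes. [folklore] -/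
@[simp] theorem gIntegral_zero
    (gN : PseudoRiemannianMetric (𝓡 4) ∞ (EuclideanSpace ℝ (Fin 4)) (TangentSpace (𝓡 4) : N → Type _))
    (hgN : gN.IsRiemannian) : gIntegral gN hgN (fun _ ↦ 0) = 0 := by
  simp [gIntegral]

/-- **The Fisher form of the family `θ` in Hellinger normalisation**: the pull-back of the flat
`L²(N, dvol_{gN})` inner product under `w ↦ θ w`, `𝓘_θ(w)(X, Y) = ∫_N D1θ(X) · D1θ(Y) dvol`. For
`θ = 2√ρ` this is the Fisher–Rao / information form `∫ δ_Xρ δ_Yρ / ρ` of the density family `ρ`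
(Groisser–Murray 1997 (metric1); Friedrich 1991; Amari–Nagaoka 2000 §2.2).
[cite: GroisserMurray1997, §2 (metric1)] -/
def fisherForm (gN : PseudoRiemannianMetric (𝓡 4) ∞ (EuclideanSpace ℝ (Fin 4)) (TangentSpace (𝓡 4) : N → Type _))
    (hgN : gN.IsRiemannian) (θ : W → N → ℝ) (w : W) (X Y : EuclideanSpace ℝ (Fin 5)) : ℝ :=
  gIntegral gN hgN (fun x ↦ D1 θ w X x * D1 θ w Y x)

/-- The Fisher form is symmetric. [folklore] -/
theorem fisherForm_comm (gN : PseudoRiemannianMetric (𝓡 4) ∞ (EuclideanSpace ℝ (Fin 4)) (TangentSpace (𝓡 4) : N → Type _))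
    (hgN : gN.IsRiemannian) (θ : W → N → ℝ) (w : W) (X Y : EuclideanSpace ℝ (Fin 5)) :
    fisherForm gN hgN θ w X Y = fisherForm gN hgN θ w Y X := by
  simp only [fisherForm, mul_comm]

/-- **`h` is the normal part of the Hessian of `θ` at `w` on `(X, Y)`** — the second fundamental form
`II_w(X,Y) ∈ L²(N)` of the map `w ↦ θ w` into flat `L²(N, dvol_{gN})`: `D2 θ w X Y − h` is TANGENTIAL
(an `L²`-combination `D1 θ w Z` of first derivatives) and `h` is `L²`-orthogonal to every first
derivative. When `𝓘_θ(w)` is positive definite such an `h` exists and is unique (orthogonal projection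
onto the 5-plane `{D1 θ w Z}`); the first clause makes it continuous whenever `θ` is jointly smooth.
[cite: LeeRiemannianManifolds2018, Ch. 8 (second fundamental form)] -/
def IsNormalPart (gN : PseudoRiemannianMetric (𝓡 4) ∞ (EuclideanSpace ℝ (Fin 4)) (TangentSpace (𝓡 4) : N → Type _))
    (hgN : gN.IsRiemannian) (θ : W → N → ℝ) (w : W) (X Y : EuclideanSpace ℝ (Fin 5)) (h : N → ℝ) : Prop :=
  (∃ Z : EuclideanSpace ℝ (Fin 5), ∀ x, D2 θ w X Y x - h x = D1 θ w Z x) ∧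
  (∀ Z : EuclideanSpace ℝ (Fin 5), gIntegral gN hgN (fun x ↦ h x * D1 θ w Z x) = 0)

/-- Non-vacuity of `IsNormalPart`: for the zero family, the zero function is a normal part of the
Hessian on every pair of directions. [folklore] -/
theorem isNormalPart_zero (gN : PseudoRiemannianMetric (𝓡 4) ∞ (EuclideanSpace ℝ (Fin 4)) (TangentSpace (𝓡 4) : N → Type _))
    (hgN : gN.IsRiemannian) (w : W) (X Y : EuclideanSpace ℝ (Fin 5)) :
    IsNormalPart gN hgN (fun (_ : W) (_ : N) ↦ (0 : ℝ)) w X Y (fun _ ↦ 0) := by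
  refine ⟨⟨0, fun x ↦ by simp⟩, fun Z ↦ ?_⟩
  simp

/-- **The saddle form** of three normal parts `h_XX = II(X,X)`, `h_XY = II(X,Y)`, `h_YY = II(Y,Y)`:
`‖h_XY‖²_{L²} − ⟨h_XX, h_YY⟩_{L²}` — minus the Gauss term of the flat Gauss equation. Saddle
dominance is `0 ≤ saddleForm`. [folklore] -/
def saddleForm (gN : PseudoRiemannianMetric (𝓡 4) ∞ (EuclideanSpace ℝ (Fin 4)) (TangentSpace (𝓡 4) : N → Type _))
    (hgN : gN.IsRiemannian) (hXX hXY hYY : N → ℝ) : ℝ :=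
  gIntegral gN hgN (fun x ↦ hXY x ^ 2) - gIntegral gN hgN (fun x ↦ hXX x * hYY x)

/-- The saddle form of three zero normal parts vanishes. [folklore] -/
@[simp] theorem saddleForm_zero (gN : PseudoRiemannianMetric (𝓡 4) ∞ (EuclideanSpace ℝ (Fin 4)) (TangentSpace (𝓡 4) : N → Type _))
    (hgN : gN.IsRiemannian) :
    saddleForm gN hgN (fun _ ↦ 0) (fun _ ↦ 0) (fun _ ↦ 0) = 0 := by
  simp [saddleForm]

end Vocabulary

/-! ## The Hellinger map of a model of the charge-one moduli space -/

section Instantons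

variable {S : HomotopySphere 4} [Nonempty S.carrier]
  {g : PseudoRiemannianMetric (𝓡 4) ∞ (EuclideanSpace ℝ (Fin 4)) (TangentSpace (𝓡 4) : S.carrier → Type _)}
variable {W : Type*} [TopologicalSpace W] [ChartedSpace (EuclideanSpace ℝ (Fin 5)) W]

/-- **The Hellinger (square-root) map of a model `ι : W → M₁(Σ, g)`**: `w ↦ 2 √ρ_{ι w}`, `ρ = |F_A|²_g`
the curvature density of the class (tree `AsdModuliSpace.density`). Since `∫ ρ_A dvol_g = 8π²`
(charge one) it lands in the `L²`-sphere of radius `2√(8π²)`, and its Fisher form is Hitchin's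
information metric `g_I` (Hitchin 1990; Groisser–Murray 1997 §2). [cite: GroisserMurray1997, §2] -/
def hellinger (ι : W → AsdModuliSpace g S.orientation 1) (w : W) (x : S.carrier) : ℝ :=
  2 * Real.sqrt ((ι w).density g x)

omit [TopologicalSpace W] [ChartedSpace (EuclideanSpace ℝ (Fin 5)) W] in
/-- The Hellinger map is non-negative pointwise. [folklore] -/
theorem hellinger_nonneg (ι : W → AsdModuliSpace g S.orientation 1) (w : W) (x : S.carrier) :
    0 ≤ hellinger ι w x :=
  mul_nonneg zero_le_two (Real.sqrt_nonneg _)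

/-- **`ι : W → M₁(Σ, g)` is a smooth model of the collar component(s) of the moduli space**: an open
topological embedding with closed range (so `range ι` is a union of connected components of `M₁`)
containing every sufficiently CONCENTRATED class (`sup ρ ≥ R₀` — the Uhlenbeck end, where
`sup ρ_A = 48/λ⁴ → ∞`), such that the universal density `(w, x) ↦ ρ_{ι w}(x)` is jointly smooth on
`W × Σ`. For Freed–Uhlenbeck-generic `g` the `C^∞`/Kuranishi structure of `M₁ = M₁^*` restricted to
the collar component is such a model (Freed–Uhlenbeck 1984 Ch. 3; Donaldson–Kronheimer §4.2; no
existence is asserted here). [cite: FreedUhlenbeck1984, Ch. 3] -/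
def IsModuliModel (ι : W → AsdModuliSpace g S.orientation 1) : Prop :=
  IsOpenEmbedding ι ∧ IsClosed (Set.range ι) ∧
  (∃ R₀ : ℝ, ∀ c : AsdModuliSpace g S.orientation 1, (∃ x, R₀ ≤ c.density g x) → c ∈ Set.range ι) ∧
  ContMDiff ((𝓡 5).prod (𝓡 4)) 𝓘(ℝ, ℝ) ∞ (fun p : W × S.carrier ↦ (ι p.1).density g p.2)

/-- A moduli model is an open embedding (projection of the interface). [folklore] -/
theorem IsModuliModel.isOpenEmbedding {ι : W → AsdModuliSpace g S.orientation 1}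
    (h : IsModuliModel ι) : IsOpenEmbedding ι :=
  h.1

/-- Along a moduli model the universal density is jointly smooth (projection of the interface).
[folklore] -/
theorem IsModuliModel.contMDiff_density {ι : W → AsdModuliSpace g S.orientation 1}
    (h : IsModuliModel ι) :
    ContMDiff ((𝓡 5).prod (𝓡 4)) 𝓘(ℝ, ℝ) ∞ (fun p : W × S.carrier ↦ (ι p.1).density g p.2) :=
  h.2.2.2

end Instantons

end Summit.SmoothPoincare4.SmoothPoincare4.Cruxes.AhHadamardFilling.FisherSphereGauss

end
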